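import Literature.AlgebraicGeometry.HodgeTheory.MotivatedClassesLefschetzStarStable
import Literature.AlgebraicGeometry.HodgeTheory.MotivatedClassesRationalSpan
import Literature.AlgebraicGeometry.HodgeTheory.HodgeRiemannPolarizabilityProofs
import Literature.AlgebraicGeometry.HodgeTheory.MotivatedClassesHodgeClassesHolds
import Literature.AlgebraicGeometry.HodgeTheory.HodgeIndexPrimitiveAlgebraicProofs
import Literature.AlgebraicGeometry.HodgeTheory.HomologicalNumericalEquivalenceOfLefschetzStandard
import HarnessLib

/-!
# André's Prop. 3.3 on the real carriers: «≡ est l'égalité sur A_mot(X)» — homological and numerical equivalence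
# coincide on motivated classes (the cup pairing `A_motᵖ(X)_ℂ × A_mot^{n-p}(X)_ℂ → H^{2n}` is non-degenerate),
# unconditionally

Y. André, *Pour une théorie inconditionnelle des motifs*, Publ. Math. IHÉS 83 (1996), Prop. 3.3 (pp. 21–22):
«Supposons que `K` soit de caractéristique nulle et que `H` soit une cohomologie classique … Alors `Q = ℚ`, et `≡` est
l'égalité sur `A_mot(X)`. La `ℚ`-algèbre `C_mot(X, X)` est semi-simple de dimension finie. … Preuve. … Le théorème de
l'indice de Hodge entraîne que `(x, y) ↦ ⟨x ∪ *_H y⟩` définit un produit scalaire sur les cycles motivés (car ceux-ci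
sont clairement de type `(p,p)`). Comme `*_H` est un automorphisme de `A_mot(X)` (prop. 4), la forme `(x, y) ↦ ⟨x ∪ y⟩`
est donc non dégénérée sur `A_mot(X)`, c'est-à-dire que `≡` est l'égalité.» Here `≡` is numerical equivalence of
motivated cycles. On the real carriers the automorphism «prop. 4» is André's Prop. 2.2 Cor. 1–2
(`HodgeTheory/MotivatedClassesLefschetzStarStable`), and the Hodge index input is the second Hodge–Riemann relation of
the tree's Kähler–rational datum (`KaehlerRationalDatum.cform_conj_pos`).

* Part 1 `exists_polarizationForm_eq_trace_cupProduct` — the polarisation form of the Lefschetz decomposition is a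
  cup product: `Q(x, ·) = τ(z ∪ ·)` with `z = Σ_P ± L^{n-a-t} ξ_P x` lying in every submodule containing these
  Lefschetz terms of `x` (any topological space, any coefficient ring; Voisin I Lemma 6.29 / Thm. 6.32);
* Part 2 `span_hodge_le_typePiece` — `span_ℂ Hdg^p` lies in the `(p,p)` type piece of every Hodge model;
* Part 3 §1 `conjClass_mem_motivatedClasses` — `A_motᵖ(X)_ℂ` is stable under complex conjugation (it is the `ℂ`-span
  of its RATIONAL classes, André Prop. 3.2.1/3.3, the tree's `span_isRationalClass_isMotivatedClass`);
* Part 3 §2 **`eq_zero_of_forall_cupProduct_motivated_eq_zero`** (left) and **`…'`** (right): for `X` smooth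
  projective of dimension `n`, `p + q = n`, a motivated class `ξ ∈ A_motᵖ(X)_ℂ` cup-orthogonal to `A_mot^q(X)_ℂ`
  vanishes — `Q_D(conj ξ, ξ) = τ(z ∪ ξ)` with `z ∈ A_mot^q` built from the Lefschetz terms `L^{n-a-t} ξ_P(conj ξ)`,
  which are MOTIVATED by Prop. 2.2 Cor. 2 (`lefschetzPowTo_primitivePart_mem_motivatedClasses`);
  `nondegenerate_motivatedClasses` packages both sides. For ALGEBRAIC classes the same statement is Grothendieck's
  standard conjecture `D(X)` (open); for motivated classes it is a theorem.
* Part 3 §3 `finrank_motivatedClasses_eq` — `dim A_motᵖ(X)_ℂ = dim A_mot^{n-p}(X)_ℂ` (`*_η` is a bijection, Cor. 1).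

Theorems only: no definition, no named fact.

Provenance: Literature home (namespace `Literature.AlgebraicGeometry.HodgeTheory.MotivatedAlgebra`) of the
Summits-side `HodgeConjecture/Theorems/Ring2HypothesesDescentMotivatedNumerical` (Part 3) and of
`exists_polarizationForm_eq_trace_cupProduct`, `span_hodge_le_typePiece` of `…/Ring2AbelianAllAndreHodgeNondegenerate`
(Parts 1–2) (imports `Literature/` and Mathlib only). Lane `lit-hodgefound`, seat p20.

## References

* [Andre1996Motifs] Y. André, *Pour une théorie inconditionnelle des motifs*, Publ. Math. IHÉS 83 (1996), Prop. 3.3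
  (pp. 21–22), Prop. 3.2.1 (p. 20), Prop. 2.2 Cor. 1–2 (p. 16).
* [Kleiman1968AlgebraicCycles] S. Kleiman, *Algebraic cycles and the Weil conjectures* (1968), §3, Prop. 3.8,
  Cor. 3.9, 3.11.
* [VoisinHodgeI2002] C. Voisin, *Hodge Theory and Complex Algebraic Geometry I* (2002), Cor. 6.12, §6.2.3 Lemma 6.29,
  §6.3.2 Thm. 6.32, §7.1.1–7.1.2.
* [Grothendieck1968] A. Grothendieck, *Standard conjectures on algebraic cycles* (1969), §3 p. 196 (`D(X)`).
* [HatcherAT2002] A. Hatcher, *Algebraic Topology* (2002), §3.2 Thm. 3.11.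
-/

noncomputable section

namespace Literature.AlgebraicGeometry.HodgeTheory.MotivatedAlgebra

open _root_.CategoryTheory _root_.AlgebraicGeometry MonoidalCategory CartesianMonoidalCategory
open Literature.AlgebraicTopology.SingularHomology Literature.Geometry.Kaehler
open Literature.AlgebraicGeometry Literature.AlgebraicGeometry.Motives
open Literature.AlgebraicGeometry.HodgeTheory.MotivatedPullback

/-! ## Part 1: The polarisation form of the Lefschetz decomposition is a cup product -/

section Part1

universe u v

variable {Y : Type u} [TopologicalSpace Y] {R : Type v} [CommRing R] {κ : singularCohomology R R Y 2} {n : ℕ}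

/-- **The polarisation form of the Lefschetz decomposition is a cup product**: for `x ∈ Hⁱ(Y; R)` and
`m + i = 2n` there is `z ∈ Hᵐ(Y; R)` with `Q(x, y) = τ(z ∪ y)` for all `y` — namely
`z = Σ_{P=(a,t), a+t ≤ n} (-1)^{a(a-1)/2} L^{n-a-t} ξ_P x` (cup-product bridge `L^{n-a} u ∪ ξ_P y = L^{n-a-t} u ∪ y`
for `u` primitive, `SmoothFamilyGysinKernel.cupProduct_lefschetzPowTo_primitivePart_eq`) — and `z` lies in every submodule `M` containing these Lefschetz terms of `x`.
[cite: VoisinHodgeI2002, §6.2.3 Lemma 6.29 and §6.3.2 Thm. 6.32] [cite: HatcherAT2002, §3.2 Thm. 3.11] -/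
theorem exists_polarizationForm_eq_trace_cupProduct (hL : HasHardLefschetzProperty κ n)
    (hvan : ∀ m, 2 * n < m → Subsingleton (singularCohomology R R Y m))
    (τ : singularCohomology R R Y (2 * n) →ₗ[R] R) {i m : ℕ} (hmi : m + i = 2 * n)
    (x : singularCohomology R R Y i) (M : Submodule R (singularCohomology R R Y m))
    (hM : ∀ (P : {p : ℕ × ℕ // p.1 + 2 * p.2 = i}) (s' : ℕ) (hs' : P.1.1 + P.1.2 + s' = n)
      (hq : P.1.1 + 2 * s' = m), lefschetzPowTo κ s' P.1.1 m hq (primitivePart κ n hL hvan P x) ∈ M) :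
    ∃ z ∈ M, ∀ y : singularCohomology R R Y i,
      polarizationForm κ n hL hvan τ i x y = τ (cupProduct hmi z y) := by
  classical
  -- the candidate `z`
  let zP : {p : ℕ × ℕ // p.1 + 2 * p.2 = i} → singularCohomology R R Y m := fun P ↦
    if hP : P.1.1 + P.1.2 ≤ n then
      ((-1 : R) ^ (P.1.1 * (P.1.1 - 1) / 2)) •
        lefschetzPowTo κ (n - P.1.1 - P.1.2) P.1.1 m (by have := P.2; omega) (primitivePart κ n hL hvan P x)
    else 0
  refine ⟨∑ P, zP P, Submodule.sum_mem _ fun P _ ↦ ?_, fun y ↦ ?_⟩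
  · by_cases hP : P.1.1 + P.1.2 ≤ n
    · simp only [zP, dif_pos hP]
      exact Submodule.smul_mem _ _ (hM P (n - P.1.1 - P.1.2) (by omega) (by have := P.2; omega))
    · simp only [zP, dif_neg hP]
      exact Submodule.zero_mem _
  · rw [polarizationForm_apply, map_sum, LinearMap.sum_apply, map_sum]
    refine Finset.sum_congr rfl fun P _ ↦ ?_
    have hP2 := P.2
    by_cases hP : P.1.1 + P.1.2 ≤ n
    · obtain ⟨s, hs⟩ : ∃ s, P.1.1 + s = n := ⟨n - P.1.1, by omega⟩
      rw [hodgeRiemannPairing_apply τ hs rfl (by omega : (P.1.1 + 2 * s) + P.1.1 = 2 * n),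
        SmoothFamilyGysinKernel.cupProduct_lefschetzPowTo_primitivePart_eq κ hL hvan P (primitivePart_mem hL hvan P x) y hs rfl
          (by omega) (show P.1.1 + P.1.2 + (n - P.1.1 - P.1.2) = n by omega)
          (show P.1.1 + 2 * (n - P.1.1 - P.1.2) = m by omega) hmi]
      simp only [zP, dif_pos hP, map_smul, LinearMap.smul_apply, smul_eq_mul]
    · have hlt : n < P.1.1 + P.1.2 := not_le.1 hP
      simp only [zP, dif_neg hP, map_zero, LinearMap.zero_apply, primitivePart_of_lt hL hvan P hlt]

end Part1

/-! ## Part 2: `span_ℂ Hdg^p` lies in the `(p,p)` type piece -/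

section Part2

variable {n : ℕ} {X : SchemeOver ℂ}

/-- `span_ℂ Hdg^p` lies in the type piece `(p,p)` of every Hodge model. [cite: VoisinHodgeI2002, §7.1.1] -/
theorem span_hodge_le_typePiece (hX : IsSmoothProjective n X) (A : HodgeModel n X) (p : ℕ)
    (hpp : (p, p) ∈ Finset.HasAntidiagonal.antidiagonal (2 * p)) :
    Submodule.span ℂ {c : complexBetti X (2 * p) | IsRationalClass c ∧ IsOfHodgeType n X (2 * p) p p c} ≤
      A.typePiece (2 * p) ⟨(p, p), hpp⟩ :=
  Submodule.span_le.2 fun _ hc ↦ A.mem_typePiece_of_isOfHodgeType hodgePQ_independent_of_hodgeModel_holds hX hpp hc.2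

end Part2

/-! ## Part 3: André's Prop. 3.3: the cup pairing on motivated classes is non-degenerate -/

section Part3

variable {n : ℕ} {X : SchemeOver ℂ}

/-! ## §1 `A_mot(X)_ℂ` is stable under complex conjugation -/

/-- **`A_motᵖ(X)_ℂ` is stable under complex conjugation**: it is the `ℂ`-span of its rational classes (André
Prop. 3.2.1 with Prop. 3.3, the tree's `span_isRationalClass_isMotivatedClass`), and rational classes are real.
[cite: Andre1996Motifs, Prop. 3.2.1 (p. 20) and Prop. 3.3 (p. 21)] [cite: VoisinHodgeI2002, Cor. 6.12] -/
theorem conjClass_mem_motivatedClasses (hX : IsSmoothProjective n X) (p : ℕ) {c : complexBetti X (2 * p)}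
    (hc : c ∈ motivatedClasses n X p) : conjClass (ComplexPoints X) (2 * p) c ∈ motivatedClasses n X p := by
  rw [← span_isRationalClass_isMotivatedClass hX p] at hc ⊢
  induction hc using Submodule.span_induction with
  | mem c hmem => rw [hmem.1.conjClass_eq]; exact Submodule.subset_span hmem
  | zero => rw [conjClass_zero]; exact Submodule.zero_mem _
  | add c c' _ _ ihc ihc' => rw [conjClass_add]; exact Submodule.add_mem _ ihc ihc'
  | smul a c _ ihc => rw [conjClass_smul]; exact Submodule.smul_mem _ _ ihc

/-! ## §2 «≡ est l'égalité sur `A_mot(X)`»: the cup pairing is non-degenerate on motivated classes -/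

/-- **LEFT NON-DEGENERACY OF THE CUP PAIRING ON MOTIVATED CLASSES (André 1996, Prop. 3.3: homological = numerical
equivalence on `A_mot(X)`).** For `X` smooth projective of dimension `n`, `p + q = n`, and `ξ ∈ A_motᵖ(X)_ℂ`: if
`ξ ∪ h = 0` for every `h ∈ A_mot^q(X)_ℂ`, then `ξ = 0`. Proof (André's, on the real carriers): with a
Kähler–rational datum `D` of `X` (Kähler class `η`, a polarisation class) and `x = conj ξ ∈ A_motᵖ`
(`conjClass_mem_motivatedClasses`), `Q_D(x, ·) = τ(z ∪ ·)` for the class `z = Σ_P ± L^{n-a-t} ξ_P x`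
(`exists_polarizationForm_eq_trace_cupProduct`), which is MOTIVATED of codimension `q` by Prop. 2.2
Cor. 2 (`lefschetzPowTo_primitivePart_mem_motivatedClasses`); so `Q_D(x, conj x) = ± τ(ξ ∪ z) = 0`, and `x = 0` by the
second Hodge–Riemann relation for classes of pure type `(p,p)` (`KaehlerRationalDatum.cform_conj_pos`; motivated
classes lie in the Hodge span, `Andre1996_motivatedClasses_le_span_hodgeClasses_holds`).
[cite: Andre1996Motifs, Prop. 3.3 (pp. 21–22)] [cite: Kleiman1968AlgebraicCycles, §3 Prop. 3.8 and 3.11]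
[cite: VoisinHodgeI2002, §6.3.2 Thm. 6.32 and §7.1.2] -/
theorem eq_zero_of_forall_cupProduct_motivated_eq_zero (hX : IsSmoothProjective n X) {p q : ℕ} (hpq : p + q = n)
    {ξ : complexBetti X (2 * p)} (hξ : ξ ∈ motivatedClasses n X p)
    (h : ∀ h ∈ motivatedClasses n X q, cupProduct (show 2 * p + 2 * q = 2 * n by omega) ξ h = 0) :
    ξ = 0 := by
  obtain ⟨D⟩ := nonempty_kaehlerRationalDatum hX
  obtain ⟨A⟩ := nonempty_hodgeModel_holds hX
  have hη : IsPolarizationClass n X D.Hη := D.isPolarizationClass_Hη hX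
  set x := conjClass (ComplexPoints X) (2 * p) ξ with hxdef
  have hx : x ∈ motivatedClasses n X p := conjClass_mem_motivatedClasses hX p hξ
  -- `Q_D(x, ·) = τ(z ∪ ·)` with `z ∈ A_mot^q` (Prop. 2.2 Cor. 2)
  obtain ⟨z, hz, hQ⟩ := exists_polarizationForm_eq_trace_cupProduct (D.hLℂ hX)
    (subsingleton_of_lt hX ℂ) (D.cTrace hX) (show 2 * q + 2 * p = 2 * n by omega) x (motivatedClasses n X q)
    (fun P s' hs' hq' ↦ by
      obtain ⟨⟨a, t⟩, hP⟩ := P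
      dsimp only at hs' hq' ⊢
      obtain ⟨q₁, rfl⟩ : ∃ q₁, a = 2 * q₁ := ⟨p - t, by omega⟩
      exact lefschetzPowTo_primitivePart_mem_motivatedClasses hX hη hx q₁ t hP s' hq')
  -- `Q_D(x, conj x) = τ(z ∪ ξ) = ± τ(ξ ∪ z) = 0`
  have h0 : D.cform hX (2 * p) x (conjClass (ComplexPoints X) (2 * p) x) = 0 := by
    rw [hxdef, conjClass_conjClass ξ, ← hxdef, KaehlerRationalDatum.cform, hQ,
      cupProduct_gradedComm_holds ℂ (ComplexPoints X) (show 2 * q + 2 * p = 2 * n by omega)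
        (show 2 * p + 2 * q = 2 * n by omega) z ξ, h z hz, smul_zero, map_zero]
  -- Hodge–Riemann: `x = 0`
  by_contra hξ0
  have hx0 : x ≠ 0 := by
    intro hx0
    apply hξ0
    rw [← conjClass_conjClass ξ, ← hxdef, hx0, conjClass_zero]
  have hpp : (p, p) ∈ Finset.HasAntidiagonal.antidiagonal (2 * p) := Finset.HasAntidiagonal.mem_antidiagonal.2 (by omega)
  have hxA : x ∈ A.typePiece (2 * p) ⟨(p, p), hpp⟩ :=
    span_hodge_le_typePiece hX A p hpp (Andre1996_motivatedClasses_le_span_hodgeClasses_holds hX p hx)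
  obtain ⟨r, hr, hQr⟩ := D.cform_conj_pos hX A hpp hxA hx0
  rw [h0, mul_zero] at hQr
  exact hr.ne' (by exact_mod_cast hQr.symm)

/-- **RIGHT NON-DEGENERACY** (the same with `p`, `q` exchanged; graded commutativity in even degrees).
[cite: Andre1996Motifs, Prop. 3.3 (pp. 21–22)] -/
theorem eq_zero_of_forall_cupProduct_motivated_eq_zero' (hX : IsSmoothProjective n X) {p q : ℕ} (hpq : p + q = n)
    {h : complexBetti X (2 * q)} (hh : h ∈ motivatedClasses n X q)
    (h0 : ∀ ξ ∈ motivatedClasses n X p, cupProduct (show 2 * p + 2 * q = 2 * n by omega) ξ h = 0) :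
    h = 0 := by
  refine eq_zero_of_forall_cupProduct_motivated_eq_zero hX (show q + p = n by omega) hh fun ξ hξ ↦ ?_
  rw [cupProduct_gradedComm_holds ℂ (ComplexPoints X) (show 2 * q + 2 * p = 2 * n by omega)
    (show 2 * p + 2 * q = 2 * n by omega) h ξ, h0 ξ hξ, smul_zero]

/-- **André 1996, Prop. 3.3 on the real carriers — «≡ est l'égalité sur `A_mot(X)`», packaged**: for every smooth
projective complex `X` of dimension `n` and `p + q = n`, the cup product pairing
`A_motᵖ(X)_ℂ × A_mot^q(X)_ℂ → H^{2n}(X(ℂ); ℂ)` is non-degenerate on both sides — numerical and homological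
equivalence agree on motivated classes, UNCONDITIONALLY. (For algebraic classes this is Grothendieck's standard conjecture `D(X)`, open.)
[cite: Andre1996Motifs, Prop. 3.3 (pp. 21–22)] [cite: Grothendieck1968, §3 p. 196] -/
theorem nondegenerate_motivatedClasses (hX : IsSmoothProjective n X) {p q : ℕ} (hpq : p + q = n) :
    (∀ ξ ∈ motivatedClasses n X p,
        (∀ b ∈ motivatedClasses n X q, cupProduct (show 2 * p + 2 * q = 2 * n by omega) ξ b = 0) → ξ = 0) ∧
      (∀ b ∈ motivatedClasses n X q,
        (∀ ξ ∈ motivatedClasses n X p, cupProduct (show 2 * p + 2 * q = 2 * n by omega) ξ b = 0) → b = 0) :=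
  ⟨fun _ hξ hb ↦ eq_zero_of_forall_cupProduct_motivated_eq_zero hX hpq hξ hb,
    fun _ hb hξ ↦ eq_zero_of_forall_cupProduct_motivated_eq_zero' hX hpq hb hξ⟩

/-! ## §3 `dim A_motᵖ(X)_ℂ = dim A_mot^{n-p}(X)_ℂ` -/

/-- **`dim_ℂ A_motᵖ(X)_ℂ = dim_ℂ A_mot^{p'}(X)_ℂ` for `p + p' = n`**: André's `*_η` (any polarisation class `η`)
restricts to a linear bijection between the two (Prop. 2.2 Cor. 1, `map_lefschetzInvolution_motivatedClasses_eq`).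
[cite: Andre1996Motifs, Prop. 2.2 Cor. 1 (p. 16) and Prop. 3.3 (p. 21)] -/
theorem finrank_motivatedClasses_eq (hX : IsSmoothProjective n X) {η : complexBetti X 2}
    (hη : IsPolarizationClass n X η) {p p' : ℕ} (hpp' : p + p' = n) :
    Module.finrank ℂ (motivatedClasses n X p) = Module.finrank ℂ (motivatedClasses n X p') := by
  have h : 2 * p + 2 * p' = 2 * n := by omega
  rw [← map_lefschetzInvolution_motivatedClasses_eq hX hη h]
  exact LinearEquiv.finrank_eq (Submodule.equivMapOfInjective _
    (lefschetzInvolution_bijective hη.hasHardLefschetz h).1 (motivatedClasses n X p))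

end Part3

end Literature.AlgebraicGeometry.HodgeTheory.MotivatedAlgebra

end
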